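import Literature.AlgebraicGeometry.Resolution.AlterationsStrictTransform
import Literature.AlgebraicGeometry.Resolution.AlterationsPreSemiStablePullback
import Literature.AlgebraicGeometry.Resolution.EmbeddedResolutionCentre
import HarnessLib

/-!
# De Jong's alteration theorem, 4.16: "(vi) f) is also preserved by alterations as in 4.15" — PROVED

Topic: `Literature/AlgebraicGeometry/Resolution`. Companion to `AlterationsStrictTransform.lean`
(de Jong 1996, 4.15 as the named fact `DeJong1996StrictTransform`: the strict transform
`X' = (Y' ×_Y X)_red` of a fibred pair along a generically étale projective alteration
`ψ : Y' → Y`, delivered through a surjective closed immersion `ι : X' → X ×_Y Y'` from a reduced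
scheme, with `f' = ι ≫ pr_{Y'}`, `φ = ι ≫ pr_X`, `Z' = φ⁻¹(Z)`). The last sentence of 4.16,

> "We note that (vi) f) is also preserved by alterations as in 4.15." (p. 71)

is PROVED here for any such `ι` over any `ψ : Y' → Y` with `Y'` reduced:

* `DeJong1996.strictTransformSection hσ ψ ι i` — the section `σ'ᵢ : Y' → X'` of `f'` induced by
  a section `σᵢ` of `f`: the pulled-back section `(σᵢ ∘ ψ, 𝟙) : Y' → X ×_Y Y'`
  (`PreSemiStablePair.pullbackSection`) lifts through the closed immersion `ι`, because `Y'` is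
  reduced and `ι` is onto (`IsClosedImmersion.lift`); proved: `σ'ᵢ ≫ ι = (σᵢ ∘ ψ, 𝟙)`,
  `σ'ᵢ ≫ f' = 𝟙`, `σ'ᵢ ≫ φ = ψ ≫ σᵢ`, and `σ'ᵢ(Y') = φ⁻¹(σᵢ(Y))`;
* `DeJong1996.IsUnionOfSections.of_finite_family` — (vi) f) from ANY finite family of sections
  whose images cover `Z` exactly (the family is made injective by discarding repetitions);
* `DeJong1996.IsUnionOfSections.strictTransform` — **if `Z = ⋃ σᵢ(Y)` is a union of sections of
  `f`, then `Z' = φ⁻¹(Z) = ⋃ σ'ᵢ(Y')` is a union of sections of `f'`.**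

## Sources

* A. J. de Jong, *Smoothness, semi-stability and alterations*, Publ. Math. IHÉS 83 (1996) 51–93:
  4.15–4.16 (p. 71).
-/

noncomputable section

open CategoryTheory CategoryTheory.Limits AlgebraicGeometry TopologicalSpace Topology

namespace Literature.AlgebraicGeometry.Resolution

universe u

/-! ## Lifting through a surjective closed immersion from a reduced scheme -/

/-- A morphism from a reduced scheme whose image lies in the image of a closed immersion `ι`
factors through `ι`: the kernel of `ι` is contained in the vanishing ideal sheaf of its image,
which is contained in that of the (closure of the) image of `g`, the kernel of `g`.
[folklore] -/
theorem Scheme.Hom.ker_le_ker_of_range_subset {X' P T : Scheme.{u}} (ι : X' ⟶ P)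
    [IsClosedImmersion ι] (g : T ⟶ P) [IsReduced T] (h : Set.range g ⊆ Set.range ι) :
    ι.ker ≤ g.ker := by
  rw [ker_eq_vanishingIdeal_of_isReduced g]
  have hcl : closure (Set.range g) ⊆ Set.range ι :=
    closure_minimal h ι.isClosedEmbedding.isClosed_range
  calc ι.ker ≤ ι.ker.radical := ι.ker.le_radical
    _ = Scheme.IdealSheafData.vanishingIdeal ι.ker.support := by
        rw [Scheme.IdealSheafData.vanishingIdeal_support]
    _ ≤ Scheme.IdealSheafData.vanishingIdeal ⟨closure (Set.range g), isClosed_closure⟩ := by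
        apply Scheme.IdealSheafData.vanishingIdeal_antimono
        intro x hx
        exact ι.range_subset_ker_support (hcl hx)

namespace DeJong1996

variable {X Y Y' X' : Scheme.{u}} {f : X ⟶ Y} {n : ℕ} {σ : Fin n → (Y ⟶ X)}

/-! ## The induced sections of the strict transform -/

/-- **The section `σ'ᵢ : Y' → X'` of the strict transform induced by a section `σᵢ` of `f`**
(de Jong 1996, 4.16: "(vi) f) is also preserved by alterations as in 4.15"): the pulled-back
section `(σᵢ ∘ ψ, 𝟙) : Y' → X ×_Y Y'` lifted through the surjective closed immersion
`ι : X' → X ×_Y Y'`, `Y'` being reduced. [cite: DeJong1996, 4.16, p. 71] -/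
def strictTransformSection (hσ : ∀ i, σ i ≫ f = 𝟙 Y) (ψ : Y' ⟶ Y) [IsReduced Y']
    (ι : X' ⟶ pullback f ψ) [IsClosedImmersion ι] [Surjective ι] (i : Fin n) : Y' ⟶ X' :=
  IsClosedImmersion.lift ι (PreSemiStablePair.pullbackSection hσ ψ i)
    (Scheme.Hom.ker_le_ker_of_range_subset ι _ (by
      rw [ι.surjective.range_eq]
      exact Set.subset_univ _))

variable (hσ : ∀ i, σ i ≫ f = 𝟙 Y) (ψ : Y' ⟶ Y) [IsReduced Y'] (ι : X' ⟶ pullback f ψ)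
  [IsClosedImmersion ι] [Surjective ι]

/-- `σ'ᵢ` lifts the pulled-back section. [folklore] -/
@[simp]
theorem strictTransformSection_ι (i : Fin n) :
    strictTransformSection hσ ψ ι i ≫ ι = PreSemiStablePair.pullbackSection hσ ψ i :=
  IsClosedImmersion.lift_fac _ _ _

/-- `σ'ᵢ` is a section of `f' = ι ≫ pr_{Y'}`. [folklore] -/
@[simp]
theorem strictTransformSection_comp_snd (i : Fin n) :
    strictTransformSection hσ ψ ι i ≫ ι ≫ pullback.snd f ψ = 𝟙 Y' := by
  rw [← Category.assoc, strictTransformSection_ι, PreSemiStablePair.pullbackSection_snd]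

/-- `σ'ᵢ` lies over `σᵢ`: `σ'ᵢ ≫ φ = ψ ≫ σᵢ` for `φ = ι ≫ pr_X`. [folklore] -/
@[simp]
theorem strictTransformSection_comp_fst (i : Fin n) :
    strictTransformSection hσ ψ ι i ≫ ι ≫ pullback.fst f ψ = ψ ≫ σ i := by
  rw [← Category.assoc, strictTransformSection_ι, PreSemiStablePair.pullbackSection_fst]

/-- **`σ'ᵢ(Y') = φ⁻¹(σᵢ(Y))`**: the image of the induced section is the preimage of the image of
the section (the square `Y' → X ×_Y Y' ← …` of a section is cartesian,
`PreSemiStablePair.range_pullbackSection`, and `ι` is a bijection onto `X ×_Y Y'`).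
[folklore] -/
theorem range_strictTransformSection (i : Fin n) :
    Set.range (strictTransformSection hσ ψ ι i) = (ι ≫ pullback.fst f ψ) ⁻¹' Set.range (σ i) := by
  have hr := PreSemiStablePair.range_pullbackSection hσ ψ i
  rw [← strictTransformSection_ι hσ ψ ι i, Scheme.Hom.comp_base, TopCat.coe_comp,
    Set.range_comp] at hr
  ext x
  constructor
  · rintro ⟨y, rfl⟩
    have : ι (strictTransformSection hσ ψ ι i y) ∈ pullback.fst f ψ ⁻¹' Set.range (σ i) := by
      rw [← hr]
      exact ⟨_, ⟨y, rfl⟩, rfl⟩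
    simpa [Set.mem_preimage, Scheme.Hom.comp_apply] using this
  · intro hx
    have hx' : ι x ∈ ι '' Set.range (strictTransformSection hσ ψ ι i) := by
      rw [hr]
      simpa [Set.mem_preimage, Scheme.Hom.comp_apply] using hx
    obtain ⟨x', hx'r, hxx'⟩ := hx'
    rw [← ι.isClosedEmbedding.injective hxx']
    exact hx'r

/-- **`φ⁻¹(⋃ σᵢ(Y)) = ⋃ σ'ᵢ(Y')`.** [cite: DeJong1996, 4.16, p. 71] -/
theorem preimage_iUnion_range_eq :
    (ι ≫ pullback.fst f ψ) ⁻¹' (⋃ i, Set.range (σ i)) =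
      ⋃ i, Set.range (strictTransformSection hσ ψ ι i) := by
  rw [Set.preimage_iUnion]
  exact Set.iUnion_congr fun i => (range_strictTransformSection hσ ψ ι i).symm

/-! ## (vi) f) from any finite family of sections, and its transport -/

namespace IsUnionOfSections

omit hσ in
/-- **(vi) f) from a finite family of sections covering `Z`**, not necessarily injective:
discard repetitions. [folklore] -/
theorem of_finite_family {I : Type*} [Finite I] {Z : Set X} (s : I → (Y ⟶ X))
    (hs : ∀ i, s i ≫ f = 𝟙 Y) (hZ : Z = ⋃ i, Set.range (s i)) : IsUnionOfSections f Z := by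
  classical
  -- the finite set of distinct sections in the family
  haveI : Finite (Set.range s) := Set.finite_range s |>.to_subtype
  obtain ⟨m, ⟨e⟩⟩ := Finite.exists_equiv_fin (Set.range s)
  refine ⟨m, fun j => (e.symm j).1, ?_, fun j => ?_, ?_⟩
  · intro j j' h
    exact e.symm.injective (Subtype.ext h)
  · obtain ⟨i, hi⟩ := (e.symm j).2
    show (e.symm j).1 ≫ f = 𝟙 Y
    rw [← hi]
    exact hs i
  · rw [hZ]
    ext x
    simp only [Set.mem_iUnion]
    constructor
    · rintro ⟨i, hx⟩
      refine ⟨e ⟨s i, i, rfl⟩, ?_⟩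
      rw [Equiv.symm_apply_apply]
      exact hx
    · rintro ⟨j, hx⟩
      obtain ⟨i, hi⟩ := (e.symm j).2
      exact ⟨i, by rw [hi]; exact hx⟩

omit hσ in
/-- **de Jong 1996, 4.16: "(vi) f) is also preserved by alterations as in 4.15" — PROVED.** If
`Z = ⋃ σᵢ(Y)` is a union of sections of `f : X → Y`, then for any `ψ : Y' → Y` with `Y'`
reduced and any surjective closed immersion `ι : X' → X ×_Y Y'` (e.g. the strict transform of
4.15), `Z' = φ⁻¹(Z)` is a union of sections of `f' = ι ≫ pr_{Y'}`, namely of the induced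
sections `σ'ᵢ` (`strictTransformSection`). [cite: DeJong1996, 4.16, p. 71] -/
theorem strictTransform {Z : Set X} (h : IsUnionOfSections f Z) :
    IsUnionOfSections (ι ≫ pullback.snd f ψ) ((ι ≫ pullback.fst f ψ) ⁻¹' Z) := by
  obtain ⟨n, σ, -, hσ, rfl⟩ := h
  exact of_finite_family (strictTransformSection hσ ψ ι)
    (fun i => strictTransformSection_comp_snd hσ ψ ι i) (preimage_iUnion_range_eq hσ ψ ι)

end IsUnionOfSections

include hσ in
/-- **The sections `σ'ᵢ` all at once** (for the transport of (vi) f), g) in 4.17 and 4.22): from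
sections `σᵢ` of `f` with `Z = ⋃ σᵢ(Y)` one gets sections `σ'ᵢ` of `f'` over the `σᵢ`
(`σ'ᵢ ≫ φ = ψ ≫ σᵢ`) with `φ⁻¹(Z) = ⋃ σ'ᵢ(Y')`. [cite: DeJong1996, 4.16–4.17, pp. 71–72] -/
theorem exists_strictTransformSections {Z : Set X} (hZ : Z = ⋃ i, Set.range (σ i)) :
    ∃ σ' : Fin n → (Y' ⟶ X'), (∀ i, σ' i ≫ ι ≫ pullback.snd f ψ = 𝟙 Y') ∧
      (∀ i, σ' i ≫ ι ≫ pullback.fst f ψ = ψ ≫ σ i) ∧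
        (∀ i, Set.range (σ' i) = (ι ≫ pullback.fst f ψ) ⁻¹' Set.range (σ i)) ∧
          (ι ≫ pullback.fst f ψ) ⁻¹' Z = ⋃ i, Set.range (σ' i) :=
  ⟨strictTransformSection hσ ψ ι, strictTransformSection_comp_snd hσ ψ ι,
    strictTransformSection_comp_fst hσ ψ ι, range_strictTransformSection hσ ψ ι,
    hZ ▸ preimage_iUnion_range_eq hσ ψ ι⟩

end DeJong1996

end Literature.AlgebraicGeometry.Resolution

end
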